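import Literature.Analysis.FluidPDE.ElgindiBlowupContinuationProofs
import Literature.Analysis.FluidPDE.AxisymmetricLiftR5
import HarnessLib

/-!
# Chen 2026: asymptotically self-similar `C^{1,α}` blow-up of swirl-free axisymmetric Euler for
# EVERY `α < 1/3`, from finite-energy data with compactly supported `C^α` vorticity — a CLAIM

Topic `Literature/Analysis/FluidPDE`. Statements file: ONE named statement (tagged as a claim: the
source is a May 2026 preprint; its `1/3`-profile input from Part I is computer-assisted), in the tree's
Hölder–Euler class `IsHolderEulerSolution` (`ElgindiBlowupContinuationProofs.lean`), and its
elementary consequences. Companion of `AxisymNoSwirlHolderThreshold.lean` (regular side `α > 1/3`: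
`Danchin2007.noSwirlHolderGlobal`; Lagrangian blow-up ∀ `α < 1/3`: `Shkoller2026.noSwirlTypeIBlowup`).
Source: `[Chen2026HolderEulerSelfSimilarII]` J. Chen, *Asymptotically self-similar blowup for 3D
incompressible Euler with `C^{1,1/3−}` velocity II: 3D profiles, blowup, and limiting behavior*,
arXiv:2605.15130 ("p." = chunk of the held text `paper:arxiv-2605.15130`).

## The printed statements (§1, p. 2–5)

Setting (§1 p. 4, §2 p. 10): axisymmetric Euler WITHOUT swirl on `ℝ³`,
`∂ₜω^θ + (u^r∂_r + u^z∂_z)ω^θ = (u^r/r)ω^θ`, with `ω, ψ` odd in `z` (preserved); Hou–Zhang's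
`C^α` gauge `ω^θ = r^α ω(r,z)`. **Theorem 1.1** (p. 5): "For any `α ∈ (0, 1/3)`, there exists a
nontrivial `C^α` self-similar blowup profile `ω̄^θ_{ss,α} ≢ 0` for the vorticity of the axisymmetric
Euler without swirl. Moreover [for `α ∈ (1/3 − ε̄, 1/3)`, `ε = 1/3 − α`] … the Euler equation admits a
self-similar blowup solution `ω^θ_{ss,α}(t, x) = (1−t)⁻¹ ω̄^θ_{ss,α}(x/(1−t)^{c_{x,α}})` with scaling
exponent `c_{x,α} ≍ ε⁻¹`, `c_{x,α} = (8/9)ε⁻¹ + O(ε^{−1+κ})` …; `ω̄^θ_{ss,α} = A_α r^α ω_s(r,z) ∈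
C^α(ℝ³)`, decay rate `α* = 1/3 + ε/8 + O(ε^{1+κ})`, `c_{x,α} = 1/(α* − α)`"; the profile has
INFINITE energy (p. 5: "`‖u‖_{L²} = ∞`"). **Theorem 1.2** (p. 5): "There exists `α₀ < 1/3` such
that the following holds for any `α ∈ (0, 1/3)`, any `δ_in > 0`, and `γ = max(α, α₀)`. There exists
compactly supported initial vorticity `ω₀^θ = r^γ g ∈ C_c^γ(ℝ³) ⊂ C_c^α(ℝ³)`, with `g ∈ C_c^∞(ℝ³)`
and the associated initial velocity `u₀ ∈ C^{1,α}(ℝ³) ∩ L²(ℝ³)`, such that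
`‖ω₀^θ − ω̄_γ‖ ≤ δ_in`, and the corresponding local solution to (eq:Euler) develops an
asymptotically self-similar blowup in finite time `T < ∞`:
`‖(T−t)·ω^θ(t, ℰ(t)·(T−t)^{c_{x,γ}} ·) − ω̄^θ_{ss,γ}(·)‖_{L^∞} ≲ (T−t)^{0.01}` for all
`t ∈ [0, T)`, where `c_{x,γ}, ω̄^θ_{ss,γ} ≢ 0` are the scaling and profile in Theorem 1.1, and
`ℰ(t) ∈ C¹([0,T))`, `ℰ(t) ≍_γ 1`. In addition `|T − 1| ≲_γ δ_in`, `‖ℰ − 1‖ ≲_γ δ_in`." Abstract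
p. 2: "This blowup result is sharp in view of the global regularity theory for axisymmetric Euler
without swirl with `C_c^α` initial vorticity for all `α ≥ 1/3`" (Shao–Wei–Zhang, Acta Math. Sin. 42
(2026); §1 p. 3). Remark 1.3 (p. 5): the low regularity comes only from the vanishing order `r^γ`
at the axis; "the decisive condition for global regularity is … `ω₀^θ/r ∈ L^{3,1}`".

## Rendering

`Chen2026.asymptSelfSimilarBlowup` [claim: under-review]: for every `0 < α < 1/3` there are a
datum `u₀` and a solution `(u, p)` in the tree's Hölder–Euler class on some `[0, T)`, `0 < T`
(`IsHolderEulerSolution α (Ico 0 T) u₀ u p`: classical Euler on `ℝ³`, `f = 0`, `u(0) = u₀`,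
slices `C^{1,α}` with finite energy and COMPACTLY SUPPORTED vorticity, `C^{1,α}` norms locally
bounded), axisymmetric, swirl-free and mirror-symmetric in `z` at every time (`u(Sx) = S u(x)`,
`S = reflC 2`: `ω^θ` odd in `z`), together with a scaling exponent `c > 0`, a continuous nowhere
vanishing vector profile `Ω̄ : ℝ³ → ℝ³` (`= ω̄^θ_{ss,γ} e_θ`), a modulation `ℰ : ℝ → ℝ` squeezed
between two positive constants, and constants `C ≥ 0`, such that for all `t ∈ [0,T)` and all `x`,
`‖(T−t) • ω(t, (ℰ(t)(T−t)^c) • x) − Ω̄(x)‖ ≤ C (T−t)^{1/100}` (`ω = curl u`; the vector form is the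
printed scalar one since `e_θ` is invariant under positive dilations). Not rendered: the closeness
`‖ω₀^θ − ω̄_γ‖ ≤ δ_in`, `|T − 1| ≲ δ_in`, `ℰ ∈ C¹`, the identification of `(c, Ω̄)` with Theorem
1.1's `(c_{x,γ}, ω̄^θ_{ss,γ})` and that theorem's asymptotics `c_{x,α} = (8/9)(1/3 − α)⁻¹ + …`
(recorded above, not vendored), uniqueness of the local solution.
Proved: asymptotic self-similarity with a nontrivial profile forces vorticity blow-up at `T`
(`vorticityBlowsUpAt_of_asymptSelfSimilar`: at a point `x₀` with `Ω̄(x₀) ≠ 0`,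
`‖ω(t, y_t)‖ ≥ (‖Ω̄(x₀)‖ − C(T−t)^{1/100})/(T−t) → ∞`), hence `exists_blowup`.

## What this is NOT

Not Navier–Stokes (inviscid, swirl-free — a class globally regular for `ν > 0`, tree
`axisymmetric_no_swirl_global_regularity`); a preprint claim; the exactly self-similar infinite-energy
solutions of Theorem 1.1 are not vendored.
-/

noncomputable section

open MeasureTheory Set Function Filter
open _root_.Topology
open scoped NNReal ENNReal

namespace Literature.Analysis.FluidPDE

namespace Chen2026

/-- **Asymptotic self-similarity of the vorticity near `T`** with exponent `c`, profile `Ω̄`,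
modulation `ℰ` and rate `(T−t)^{1/100}` — the printed display of Chen's Theorem 1.2,
`‖(T−t)·ω^θ(t, ℰ(t)(T−t)^{c}·) − ω̄(·)‖_{L^∞} ≲ (T−t)^{0.01}`, `ℰ ≍ 1`, written for the vorticity
VECTOR `ω = curl u` (equivalent, `e_θ` being dilation invariant) and pointwise in `x`.
[cite: Chen2026HolderEulerSelfSimilarII, Thm 1.2 (p. 5 of arXiv:2605.15130): the displayed estimate and ℰ(t) ≍ 1] -/
def IsAsymptSelfSimilarAt (u : ℝ → EuclideanSpace ℝ (Fin 3) → EuclideanSpace ℝ (Fin 3)) (T c : ℝ)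
    (Ω : EuclideanSpace ℝ (Fin 3) → EuclideanSpace ℝ (Fin 3)) (E : ℝ → ℝ) : Prop :=
  ∃ C a b : ℝ, 0 ≤ C ∧ 0 < a ∧ a ≤ b ∧ (∀ t ∈ Ico 0 T, a ≤ E t ∧ E t ≤ b) ∧
    ∀ t ∈ Ico 0 T, ∀ x,
      ‖(T - t) • curl (u t) ((E t * (T - t) ^ c) • x) - Ω x‖ ≤ C * (T - t) ^ (1 / 100 : ℝ)

/-- **Chen 2026 (Part II), Theorem 1.2 — a CLAIM (arXiv:2605.15130, May 2026, unrefereed; the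
`1/3`-profile of Part I is computer-assisted).** Printed (p. 5): "There exists `α₀ < 1/3` such that the
following holds for any `α ∈ (0, 1/3)`, any `δ_in > 0`, and `γ = max(α, α₀)`. There exists compactly
supported initial vorticity `ω₀^θ = r^γ g ∈ C_c^γ(ℝ³) ⊂ C_c^α(ℝ³)`, with `g ∈ C_c^∞(ℝ³)` and the
associated initial velocity `u₀ ∈ C^{1,α}(ℝ³) ∩ L²(ℝ³)`, such that `‖ω₀^θ − ω̄_γ‖ ≤ δ_in`, and the
corresponding local solution … develops an asymptotically self-similar blowup in finite time `T < ∞`: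
`‖(T−t)·ω^θ(t, ℰ(t)·(T−t)^{c_{x,γ}} ·) − ω̄^θ_{ss,γ}(·)‖_{L^∞} ≲ (T−t)^{0.01}`, ∀ `t ∈ [0,T)`,
where `c_{x,γ}, ω̄^θ_{ss,γ} ≢ 0` are the scaling and profile in Theorem 1.1, and
`ℰ(t) ∈ C¹([0,T))`, `ℰ(t) ≍_γ 1`"; setting: axisymmetric Euler without swirl, `ω` odd in `z` (§2
p. 10). **Rendering** (module docstring): for every `0 < α < 1/3` there are `u₀`, `T > 0`, `c > 0`,
a continuous profile `Ω̄` with `Ω̄(x₀) ≠ 0` for some `x₀`, a modulation `ℰ`, and `(u, p)` with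
`IsHolderEulerSolution α (Ico 0 T) u₀ u p` (finite energy, compactly supported vorticity, `C^{1,α}`
slices), axisymmetric swirl-free `z`-mirror-symmetric slices, and `IsAsymptSelfSimilarAt u T c Ω̄ ℰ`.
Not rendered: `δ_in`-closeness of the datum to the profile, `|T − 1| ≲ δ_in`, `ℰ ∈ C¹`, the link of
`(c, Ω̄)` to Theorem 1.1 and its asymptotics `c_{x,α} = (8/9)(1/3−α)⁻¹ + …`, uniqueness.
[claim: Chen2026HolderEulerSelfSimilarII, status: under-review]
[cite: Chen2026HolderEulerSelfSimilarII, Thm 1.2 and Thm 1.1 (p. 5 of arXiv:2605.15130); Abstract (p. 2); §2 (p. 10: odd in z)] -/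
def asymptSelfSimilarBlowup : Prop :=
  ∀ α : ℝ≥0, 0 < α → (α : ℝ) < 1 / 3 →
    ∃ (u₀ : EuclideanSpace ℝ (Fin 3) → EuclideanSpace ℝ (Fin 3)) (T c : ℝ)
      (Ω : EuclideanSpace ℝ (Fin 3) → EuclideanSpace ℝ (Fin 3)) (E : ℝ → ℝ)
      (u : ℝ → EuclideanSpace ℝ (Fin 3) → EuclideanSpace ℝ (Fin 3))
      (p : ℝ → EuclideanSpace ℝ (Fin 3) → ℝ),
      0 < T ∧ 0 < c ∧ Continuous Ω ∧ (∃ x₀, Ω x₀ ≠ 0) ∧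
      IsHolderEulerSolution α (Ico 0 T) u₀ u p ∧
      (∀ t ∈ Ico 0 T, IsAxisymmetric (u t) ∧ HasNoSwirl (u t) ∧
        ∀ x, u t (reflC 2 x) = reflC 2 (u t x)) ∧
      IsAsymptSelfSimilarAt u T c Ω E

/-- **Asymptotic self-similarity with a nontrivial profile forces vorticity blow-up at `T`.** If
`‖(T−t)•ω(t, λ(t)•x) − Ω̄(x)‖ ≤ C(T−t)^{1/100}` on `[0,T)` and `Ω̄(x₀) ≠ 0`, then for `t` close to
`T` the point `y_t = λ(t)x₀` carries `‖ω(t, y_t)‖ ≥ (‖Ω̄(x₀)‖ − C(T−t)^{1/100})/(T−t) → ∞`, so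
`VorticityBlowsUpAt u T`. [cite: Chen2026HolderEulerSelfSimilarII, Thm 1.2 (p. 5): "develops an asymptotically self-similar blowup in finite time T"] -/
theorem vorticityBlowsUpAt_of_asymptSelfSimilar
    {u : ℝ → EuclideanSpace ℝ (Fin 3) → EuclideanSpace ℝ (Fin 3)} {T c : ℝ}
    {Ω : EuclideanSpace ℝ (Fin 3) → EuclideanSpace ℝ (Fin 3)} {E : ℝ → ℝ} (hT : 0 < T)
    (h : IsAsymptSelfSimilarAt u T c Ω E) (hΩ : ∃ x₀, Ω x₀ ≠ 0) : VorticityBlowsUpAt u T := by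
  obtain ⟨C, a, b, hC, -, -, -, hest⟩ := h
  obtain ⟨x₀, hx₀⟩ := hΩ
  set m : ℝ := ‖Ω x₀‖ with hm
  have hm_pos : 0 < m := norm_pos_iff.2 hx₀
  intro M
  -- choose δ ≤ T with C δ^{1/100} ≤ m/2 and (m/2)/δ > M
  have hM1 : 0 < max M 0 + 1 := by positivity
  obtain ⟨δ₁, hδ₁, hδ₁C⟩ : ∃ δ₁ : ℝ, 0 < δ₁ ∧ ∀ s, 0 < s → s < δ₁ → C * s ^ (1 / 100 : ℝ) ≤ m / 2 := by
    by_cases hC0 : C = 0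
    · exact ⟨1, one_pos, fun s _ _ => by rw [hC0, zero_mul]; linarith⟩
    · have hCpos : 0 < C := lt_of_le_of_ne hC (Ne.symm hC0)
      refine ⟨(m / (2 * C)) ^ (100 : ℝ), by positivity, fun s hs hsδ => ?_⟩
      have h1 : s ^ (1 / 100 : ℝ) < ((m / (2 * C)) ^ (100 : ℝ)) ^ (1 / 100 : ℝ) :=
        Real.rpow_lt_rpow hs.le hsδ (by norm_num)
      rw [← Real.rpow_mul (by positivity), show (100 : ℝ) * (1 / 100) = 1 by norm_num,
        Real.rpow_one] at h1
      have h2 : C * s ^ (1 / 100 : ℝ) ≤ C * (m / (2 * C)) :=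
        mul_le_mul_of_nonneg_left h1.le hC
      rw [mul_div_assoc', mul_comm C m, mul_div_mul_right _ _ hC0] at h2
      exact h2
  set δ : ℝ := min (min T δ₁) ((m / 2) / (max M 0 + 1)) with hδ
  have hδpos : 0 < δ := lt_min (lt_min hT hδ₁) (by positivity)
  have hwin : ∀ᶠ t in 𝓝[<] T, t ∈ Ioo (T - δ) T := Ioo_mem_nhdsLT (by linarith)
  refine (hwin.mono fun t ht => ?_).frequently
  have hs : 0 < T - t := by linarith [ht.2]
  have hsδ : T - t < δ := by linarith [ht.1]
  have ht0 : 0 ≤ t := by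
    have : δ ≤ T := (min_le_left _ _).trans (min_le_left _ _)
    linarith [ht.1]
  have hsδ₁ : T - t < δ₁ := hsδ.trans_le ((min_le_left _ _).trans (min_le_right _ _))
  have hsM : T - t < (m / 2) / (max M 0 + 1) := hsδ.trans_le (min_le_right _ _)
  refine ⟨(E t * (T - t) ^ c) • x₀, ?_⟩
  have hkey := hest t ⟨ht0, ht.2⟩ x₀
  -- ‖(T-t) • ω‖ ≥ m - C (T-t)^{1/100} ≥ m/2
  have h1 : m - C * (T - t) ^ (1 / 100 : ℝ) ≤ (T - t) * ‖curl (u t) ((E t * (T - t) ^ c) • x₀)‖ := by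
    have := norm_sub_norm_le (Ω x₀) ((T - t) • curl (u t) ((E t * (T - t) ^ c) • x₀))
    rw [norm_smul, Real.norm_eq_abs, abs_of_pos hs] at this
    rw [norm_sub_rev] at hkey
    linarith [hm]
  have h2 : m / 2 ≤ (T - t) * ‖curl (u t) ((E t * (T - t) ^ c) • x₀)‖ := by
    linarith [hδ₁C (T - t) hs hsδ₁]
  -- hence ‖ω‖ ≥ (m/2)/(T-t) > max M 0 + 1 > M
  have h3 : (m / 2) / (T - t) ≤ ‖curl (u t) ((E t * (T - t) ^ c) • x₀)‖ := by
    rw [div_le_iff₀ hs, mul_comm]; exact h2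
  have h4 : max M 0 + 1 < (m / 2) / (T - t) := by
    rw [lt_div_iff₀ hs]
    calc (max M 0 + 1) * (T - t) < (max M 0 + 1) * ((m / 2) / (max M 0 + 1)) :=
          mul_lt_mul_of_pos_left hsM hM1
      _ = m / 2 := mul_div_cancel₀ _ hM1.ne'
  have h5 : M < max M 0 + 1 := (le_max_left M 0).trans_lt (lt_add_one _)
  linarith

/-- From the claim: for every `0 < α < 1/3`, a swirl-free axisymmetric finite-energy `C^{1,α}` Euler
flow with compactly supported vorticity on `ℝ³ × [0, T)`, `T > 0`, whose vorticity blows up at `T` —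
in the SAME class `IsHolderEulerSolution` in which `Danchin2007.noSwirlHolderGlobal` asserts global
existence for `α > 1/3`. [cite: Chen2026HolderEulerSelfSimilarII, Thm 1.2 (p. 5)] -/
theorem asymptSelfSimilarBlowup.exists_blowup (h : asymptSelfSimilarBlowup) {α : ℝ≥0} (hα : 0 < α)
    (hα3 : (α : ℝ) < 1 / 3) :
    ∃ (u₀ : EuclideanSpace ℝ (Fin 3) → EuclideanSpace ℝ (Fin 3)) (T : ℝ)
      (u : ℝ → EuclideanSpace ℝ (Fin 3) → EuclideanSpace ℝ (Fin 3))
      (p : ℝ → EuclideanSpace ℝ (Fin 3) → ℝ), 0 < T ∧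
      IsHolderEulerSolution α (Ico 0 T) u₀ u p ∧
      (∀ t ∈ Ico 0 T, IsAxisymmetric (u t) ∧ HasNoSwirl (u t)) ∧
      VorticityBlowsUpAt u T := by
  obtain ⟨u₀, T, c, Ω, E, u, p, hT, -, -, hΩ, hsol, hsym, hss⟩ := h α hα hα3
  exact ⟨u₀, T, u, p, hT, hsol, fun t ht => ⟨(hsym t ht).1, (hsym t ht).2.1⟩,
    vorticityBlowsUpAt_of_asymptSelfSimilar hT hss hΩ⟩

end Chen2026

end Literature.Analysis.FluidPDE
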